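import Summits.Ventures.CertifiedManyBodySolver.Downfold.EmeryScaleRayCell
import Summits.Ventures.CertifiedManyBodySolver.Downfold.EmeryScaleBoxChain
import HarnessLib

/-!
# THE TELESCOPED EDGE CELL OF THE SCALE COORDINATE: one `Δ′`-cell of the ceiling edge `(Δ′, a₂, b₂)` (UPPER) or floor edge `(Δ′, a₁, b₁)` (LOWER) with
# its value bound, its `t_pp` stage and its oxygen-hopping RAY stage — `T((Δ′, a₂, b, c) + s·(0,0,b,c)) ≤ (1 + s)·U` and `(1 − s)·L ≤ T((Δ′, a₁, b, c) − s·(0,0,b,c))`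
# (INFL-3to1-B §B.91 (b)–(c))

Venture CertifiedManyBodySolver, cell `pub/hubbard-downfold` (stage S1; INFLATION-RULES-3to1-B §B.91), seat hubbard-downfold-mod-4 (technique B = band
level, g40); namespace `Summit.Ventures.CertifiedManyBodySolver.Downfold.Emery`. Everything PROVED (0 sorry). WHAT THIS IS NOT: a statement about any
material; no number lives here; `U = 0` one-body kinematics of the σ model.

OBJECT. `T(θ) = t_node(θ; ε_F(θ; ν))` for rows `θ = (Δ, t_pd, t_pp, t_pp′)` with ONE `t_pp′` value `c` (thin-`c` boxes; `c` is both the `cN` and the `cP`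
of the §B.88 `T̃`). An EDGE CELL carries: a `Δ′`-interval `iD`, an energy WINDOW `W` valid for EVERY edge point of the cell (supplied from two telescoped
point brackets and the `Δ`-antitonicity of `ε_F` — `EmeryFermiEnergyExistsAll.fermiEnergyOf_mem_Icc_of_mem_box'` — by `EmeryScaleEdgeBox`), a VALUE check of
`t((Δ′, a, b_edge, c); W.lo)` (UPPER; `W.hi` LOWER) against the scaled integer bound, a `t_pp` STAGE (`EmeryScaleBoxChain.stageCheck`, anchored on the
edge family with window `W`), and per `t_pp`-cell a RAY STAGE (`EmeryScaleRayCell.rayCellCheck` cells covering `s ∈ [0, sR/SC]`).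

* §1 generic covering `coversBy`; `RCell`, `BNodeR`, `ECell`; the per-cell tests `rayCellOK`, `rayStageCheck`, `edgeCellOK`.
* §2 **`ray_stage_upper`** / **`ray_stage_lower`** (soundness of a ray stage on an anchor family).
* §3 **`edge_cell_upper`**: for every `Δ′` of the cell (window hypothesis), every `b ∈ [b₂ − wB/SC, b₂]`, every `s ∈ [0, sR/SC]`:
  `T(Δ′, a₂, b + s·b, c + s·c) ≤ (1 + s)·U/SC`; **`edge_cell_lower`**: `(1 − s)·L/SC ≤ T(Δ′, a₁, b − s·b, c − s·c)` for `b ∈ [b₁, b₁ + wB/SC]`.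
The box theorems (scaling law, covering of the extended edges) are in `EmeryScaleEdgeBox`.

Sources: three-band model [HybertsenSchluterChristensen1989, Eq. (1)]; energy-linearised one-band image [AndersenEtAl1995, §6]; interval arithmetic
[folklore] (Moore 1966).
-/

noncomputable section

namespace Summit.Ventures.CertifiedManyBodySolver.Downfold.Emery

open Real Set Literature.Analysis.ValidatedNumerics.Numerics

/-! ## §1 Data and tests -/

/-- The intervals `f x` of a list cover the scaled range `[lo, hi]` (generic form of `EmeryScaleBoxChain.covers`). [folklore] -/
def coversBy {α : Type} (f : α → FI) (lo hi : ℤ) : List α → Bool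
  | [] => false
  | x :: rest => decide ((f x).lo ≤ lo) && (decide (hi ≤ (f x).hi) || coversBy f (f x).hi hi rest)

/-- Soundness of `coversBy`. [folklore] -/
theorem exists_of_coversBy {α : Type} (f : α → FI) : ∀ (L : List α) (lo hi : ℤ), coversBy f lo hi L = true →
    ∀ s : ℝ, (lo : ℝ) ≤ s * SC → s * SC ≤ (hi : ℝ) → ∃ x ∈ L, FI.mem s (f x) := by
  intro L
  induction L with
  | nil => intro lo hi h; simp [coversBy] at h
  | cons x rest ih =>
    intro lo hi h s h1 h2
    simp only [coversBy, Bool.and_eq_true, Bool.or_eq_true, decide_eq_true_eq] at h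
    obtain ⟨hc, hrest⟩ := h
    by_cases hs : s * SC ≤ ((f x).hi : ℝ)
    · exact ⟨x, by simp, ⟨le_trans (by exact_mod_cast hc) h1, hs⟩⟩
    · push Not at hs
      rcases hrest with hhi | hrest
      · exfalso
        have : (hi : ℝ) ≤ (f x).hi := by exact_mod_cast hhi
        linarith
      · obtain ⟨x', hx', hm⟩ := ih _ _ hrest s hs.le h2
        exact ⟨x', by simp [hx'], hm⟩

/-- One step cell of a RAY stage: step interval, ray data, bisection depth, member window (UPPER hard nesting). [folklore] -/
structure RCell where
  /-- the step interval -/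
  iS : FI
  /-- move / rates -/
  cd : RayCellData
  /-- bisection depth -/
  n : ℕ
  /-- member window for the hard nesting -/
  Wh : FI

/-- A `t_pp`-cell with the ray stage anchored on its members. [folklore] -/
structure BNodeR where
  /-- the `t_pp` step cell (§B.88 kernel data) -/
  cell : SCell
  /-- the ray stage anchored on this cell's members -/
  rays : List RCell

/-- One `Δ′`-cell of a telescoped edge: `Δ′` interval, edge window, value-check depth, `t_pp`-cells with their ray stages. [folklore] -/
structure ECell where
  /-- the `Δ′` interval -/
  iD : FI
  /-- window of `ε_F` at every edge point of the cell -/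
  W : FI
  /-- bisection depth of the value check -/
  nv : ℕ
  /-- the `t_pp` stage with ray stages -/
  bnodes : List BNodeR

/-- Per-ray-cell test: the kernel ray cell check on the family box `(famD, IA, famB)` with window `W`, plus bookkeeping — direction `(0, 0, ±famB, ±IC)`,
base `t_pp′ = IC`, thin rates with the sign pattern of `ray_upper_cell` (`σp = −σh`) / `ray_lower_cell` (`σe = σp`), and (UPPER) the member floor.
[folklore] -/
def rayCellOK (upper : Bool) (IC famD IA famB W : FI) (whlo2 : ℤ) (rc : RCell) : Bool :=
  rayCellCheck upper rc.cd rc.n ⟨famD, IA, famB, rc.iS, W⟩ rc.Wh &&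
  decide (rc.cd.dD = thin 0) && decide (rc.cd.dA = thin 0) && decide (rc.cd.IC = IC) &&
  decide (rc.cd.sgE.lo = rc.cd.sgE.hi) && decide (rc.cd.sgH.lo = rc.cd.sgH.hi) && decide (rc.cd.sgP.lo = rc.cd.sgP.hi) &&
  (if upper then decide (rc.cd.dB = famB) && decide (rc.cd.dC = IC) && decide (rc.cd.sgP = rc.cd.sgH.neg) && decide (rc.Wh.lo ≤ whlo2)
    else decide (rc.cd.dB = famB.neg) && decide (rc.cd.dC = IC.neg) && decide (rc.cd.sgE = rc.cd.sgP))

/-- A ray stage: the cells cover `[0, sR]` and each passes `rayCellOK`. [folklore] -/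
def rayStageCheck (upper : Bool) (IC famD IA famB W : FI) (sR whlo2 : ℤ) (rays : List RCell) : Bool :=
  coversBy RCell.iS 0 sR rays && rays.all (rayCellOK upper IC famD IA famB W whlo2)

/-- Per-edge-cell test (UPPER: edge `(Δ′, a₂, b₂)`, `t_pp` direction `−1`, value at `W.lo`; LOWER: edge `(Δ′, a₁, b₁)`, direction `+1`, value at `W.hi`):
value check, regime scalars of the edge step, `t_pp` stage, ray stages. [folklore] -/
def edgeCellOK (upper : Bool) (IC IA IB : FI) (wB sR V whlo whlo2 : ℤ) (ec : ECell) : Bool :=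
  let eV : FI := if upper then thin ec.W.lo else thin ec.W.hi
  let dirB : FI := if upper then thin (-(SC : ℤ)) else thin (SC : ℤ)
  valueCheck upper IC V ec.nv ⟨ec.iD, IA, IB, thin 0, eV⟩ &&
  decide (0 < ec.W.lo) && decide (0 < ec.iD.lo) && decide (0 < IA.lo) && decide (0 ≤ IC.lo) && decide (0 ≤ (IB.sub IC).lo) &&
  decide ((IC.mul (thin ec.W.hi)).hi < (IA.sqr).lo) && decide ((IB.mul ec.iD).hi < ((IA.sqr).mulInt 4).lo) &&
  stageCheck upper (thin 0) (thin 0) dirB IC IC whlo ec.iD IA IB ec.W wB (ec.bnodes.map (·.cell)) &&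
  ec.bnodes.all (fun nb => rayStageCheck upper IC ec.iD IA (famOf IB nb.cell.iS dirB) nb.cell.Wout sR whlo2 nb.rays)

/-! ## §2 Ray stages -/

section RayStage

variable {IC famD IA famB W : FI} {sR whlo2 : ℤ} {rays : List RCell} {c ν : ℝ}

/-- **RAY STAGE SOUNDNESS, UPPER**: for every anchor `A = (Δ, a, b, c)` of the family, every `s ∈ [0, sR/SC]`, given `ε_F(A) ∈ W` and the member floor:
`T(Δ, a, b + s·b, c + s·c) ≤ (1 + s)·T(A)`. [folklore] -/
theorem ray_stage_upper (h : rayStageCheck true IC famD IA famB W sR whlo2 rays = true) (hC : FI.mem c IC) (hν0 : 0 < ν) (hν1 : ν < 1)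
    {Δ a b s : ℝ} (hD : FI.mem Δ famD) (hA : FI.mem a IA) (hB : FI.mem b famB) (hs0 : 0 ≤ s) (hsR : s * SC ≤ (sR : ℝ))
    (hW : FI.mem (fermiEnergyOf Δ a b c ν) W) (hcrude : (whlo2 : ℝ) / SC ≤ fermiEnergyOf Δ a (b + s * b) (c + s * c) ν) :
    scaleNodeN Δ a (b + s * b) (c + s * c) (fermiEnergyOf Δ a (b + s * b) (c + s * c) ν) /
        scaleNodeD Δ a (b + s * b) (c + s * c) (fermiEnergyOf Δ a (b + s * b) (c + s * c) ν) ≤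
      (1 + s) * (scaleNodeN Δ a b c (fermiEnergyOf Δ a b c ν) / scaleNodeD Δ a b c (fermiEnergyOf Δ a b c ν)) := by
  obtain ⟨-, -, h0⟩ := mem_dirs
  simp only [rayStageCheck, Bool.and_eq_true] at h
  obtain ⟨hcov, hall⟩ := h
  obtain ⟨rc, hrc, hsc⟩ := exists_of_coversBy RCell.iS rays 0 sR hcov s (by simpa using mul_nonneg hs0 SC_pos.le) hsR
  have hok := List.all_eq_true.1 hall rc hrc
  unfold rayCellOK at hok
  simp only [Bool.and_eq_true, decide_eq_true_eq, ↓reduceIte] at hok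
  obtain ⟨⟨⟨⟨⟨⟨⟨hcell, e1⟩, e2⟩, e3⟩, tE⟩, tH⟩, tP⟩, ⟨⟨⟨e4, e5⟩, hsgn⟩, hwh⟩⟩ := hok
  set ℓ : ℝ := (rc.cd.sgH.lo : ℝ) / SC with hℓ
  set m : ℝ := -((rc.cd.sgE.lo : ℝ) / SC) with hm
  have mH : FI.mem ℓ rc.cd.sgH := mem_val_of_thin tH
  have mE : FI.mem (-m) rc.cd.sgE := by rw [hm, neg_neg]; exact mem_val_of_thin tE
  have mP : FI.mem (-ℓ) rc.cd.sgP := by rw [hsgn, eq_thin_of_lo_eq_hi tH]; exact mem_neg_thin _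
  have hcd : FI.mem (0 : ℝ) rc.cd.dD ∧ FI.mem (0 : ℝ) rc.cd.dA ∧ FI.mem b rc.cd.dB ∧ FI.mem c rc.cd.dC ∧ FI.mem c rc.cd.IC ∧ FI.mem (-m) rc.cd.sgE ∧
      FI.mem ℓ rc.cd.sgH ∧ FI.mem (-ℓ) rc.cd.sgP := by
    refine ⟨?_, ?_, ?_, ?_, ?_, mE, mH, mP⟩
    · rw [e1]; exact h0
    · rw [e2]; exact h0
    · rw [e4]; exact hB
    · rw [e5]; exact hC
    · rw [e3]; exact hC
  have hcr : (rc.Wh.lo : ℝ) / SC ≤ fermiEnergyOf (Δ + s * 0) (a + s * 0) (b + s * b) (c + s * c) ν := by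
    simp only [mul_zero, add_zero]
    exact le_trans (div_le_div_of_nonneg_right (by exact_mod_cast hwh) SC_pos.le) hcrude
  have hT := (ray_upper_cell hcd hν0 hν1 hcell hD hA hB hsc hW hcr).1
  simp only [mul_zero, add_zero] at hT
  exact hT

/-- **RAY STAGE SOUNDNESS, LOWER**: for every anchor `A = (Δ, a, b, c)` of the family, every `s ∈ [0, sR/SC]`, given `ε_F(A) ∈ W`:
`(1 − s)·T(A) ≤ T(Δ, a, b − s·b, c − s·c)`. [folklore] -/
theorem ray_stage_lower (h : rayStageCheck false IC famD IA famB W sR whlo2 rays = true) (hC : FI.mem c IC) (hν0 : 0 < ν) (hν1 : ν < 1)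
    {Δ a b s : ℝ} (hD : FI.mem Δ famD) (hA : FI.mem a IA) (hB : FI.mem b famB) (hs0 : 0 ≤ s) (hsR : s * SC ≤ (sR : ℝ))
    (hW : FI.mem (fermiEnergyOf Δ a b c ν) W) :
    (1 - s) * (scaleNodeN Δ a b c (fermiEnergyOf Δ a b c ν) / scaleNodeD Δ a b c (fermiEnergyOf Δ a b c ν)) ≤
      scaleNodeN Δ a (b - s * b) (c - s * c) (fermiEnergyOf Δ a (b - s * b) (c - s * c) ν) /
        scaleNodeD Δ a (b - s * b) (c - s * c) (fermiEnergyOf Δ a (b - s * b) (c - s * c) ν) := by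
  obtain ⟨-, -, h0⟩ := mem_dirs
  simp only [rayStageCheck, Bool.and_eq_true] at h
  obtain ⟨hcov, hall⟩ := h
  obtain ⟨rc, hrc, hsc⟩ := exists_of_coversBy RCell.iS rays 0 sR hcov s (by simpa using mul_nonneg hs0 SC_pos.le) hsR
  have hok := List.all_eq_true.1 hall rc hrc
  unfold rayCellOK at hok
  simp only [Bool.and_eq_true, decide_eq_true_eq, Bool.false_eq_true, ↓reduceIte] at hok
  obtain ⟨⟨⟨⟨⟨⟨⟨hcell, e1⟩, e2⟩, e3⟩, tE⟩, tH⟩, tP⟩, ⟨⟨e4, e5⟩, hsgn⟩⟩ := hok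
  set u : ℝ := (rc.cd.sgP.lo : ℝ) / SC with hu
  set σh : ℝ := (rc.cd.sgH.lo : ℝ) / SC with hσh
  have mP : FI.mem u rc.cd.sgP := mem_val_of_thin tP
  have mE : FI.mem u rc.cd.sgE := by rw [hsgn]; exact mP
  have mH : FI.mem σh rc.cd.sgH := mem_val_of_thin tH
  have hcd : FI.mem (0 : ℝ) rc.cd.dD ∧ FI.mem (0 : ℝ) rc.cd.dA ∧ FI.mem (-b) rc.cd.dB ∧ FI.mem (-c) rc.cd.dC ∧ FI.mem c rc.cd.IC ∧ FI.mem u rc.cd.sgE ∧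
      FI.mem σh rc.cd.sgH ∧ FI.mem u rc.cd.sgP := by
    refine ⟨?_, ?_, ?_, ?_, ?_, mE, mH, mP⟩
    · rw [e1]; exact h0
    · rw [e2]; exact h0
    · rw [e4]; exact FI.mem_neg hB
    · rw [e5]; exact FI.mem_neg hC
    · rw [e3]; exact hC
  have hT := (ray_lower_cell hcd hν0 hν1 hcell hD hA hB hsc hW).1
  simp only [mul_zero, add_zero, mul_neg] at hT
  have e6 : b + -(s * b) = b - s * b := by ring
  have e7 : c + -(s * c) = c - s * c := by ring
  rw [e6, e7] at hT
  exact hT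

end RayStage

/-! ## §3 Edge cells -/

section EdgeCell

variable {IC IA IB : FI} {wB sR V whlo whlo2 : ℤ} {ec : ECell} {c a₀ b₀ ν : ℝ}

/-- **EDGE CELL SOUNDNESS, UPPER.** Edge `(Δ′, a₀, b₀)` = `(Δ′, a₂, b₂)`: for every `Δ′` of the cell with `ε_F(Δ′, a₀, b₀, c) ∈ W`, every `b` with
`b ≤ b₀`, `(b₀ − b)·SC ≤ wB`, every `s ∈ [0, sR/SC]`, given the two member floors:
**`T(Δ′, a₀, b + s·b, c + s·c) ≤ (1 + s)·V/SC`**. [folklore] -/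
theorem edge_cell_upper (h : edgeCellOK true IC IA IB wB sR V whlo whlo2 ec = true) (hC : FI.mem c IC) (hA : FI.mem a₀ IA) (hB : FI.mem b₀ IB)
    (hν0 : 0 < ν) (hν1 : ν < 1) {Δ' b s : ℝ} (hD : FI.mem Δ' ec.iD) (hW : FI.mem (fermiEnergyOf Δ' a₀ b₀ c ν) ec.W) (hb1 : b ≤ b₀)
    (hb2 : (b₀ - b) * SC ≤ (wB : ℝ)) (hs0 : 0 ≤ s) (hsR : s * SC ≤ (sR : ℝ))
    (hcrude : (whlo : ℝ) / SC ≤ fermiEnergyOf Δ' a₀ b c ν) (hcrude2 : (whlo2 : ℝ) / SC ≤ fermiEnergyOf Δ' a₀ (b + s * b) (c + s * c) ν) :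
    scaleNodeN Δ' a₀ (b + s * b) (c + s * c) (fermiEnergyOf Δ' a₀ (b + s * b) (c + s * c) ν) /
        scaleNodeD Δ' a₀ (b + s * b) (c + s * c) (fermiEnergyOf Δ' a₀ (b + s * b) (c + s * c) ν) ≤ (1 + s) * ((V : ℝ) / SC) := by
  obtain ⟨h1, hm1, h0⟩ := mem_dirs
  unfold edgeCellOK at h
  simp only [↓reduceIte, Bool.and_eq_true, decide_eq_true_eq] at h
  obtain ⟨⟨⟨⟨⟨⟨⟨⟨⟨hval, hWlo⟩, hD0⟩, hA0⟩, hC0⟩, hBC⟩, hregm⟩, hregq⟩, hstage⟩, hrays⟩ := h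
  -- reals
  have HΔ : 0 < Δ' := FI.pos_of_lo_pos hD hD0
  have HA : 0 < a₀ := FI.pos_of_lo_pos hA hA0
  have HC : 0 ≤ c := nonneg_of_lo_nonneg hC hC0
  have HBC : c ≤ b₀ := by have := nonneg_of_lo_nonneg (FI.mem_sub hB hC) hBC; linarith
  set E := fermiEnergyOf Δ' a₀ b₀ c ν with hE
  have hWI := mem_Icc_of_fimem hW
  have HWlo : 0 < (ec.W.lo : ℝ) / SC := div_pos (by exact_mod_cast hWlo) SC_pos
  -- (1) the edge value: T̃(Δ′, a₀, b₀) ≤ t(·; W.lo) ≤ V/SC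
  have hm : c * E < a₀ ^ 2 := by
    have := FI.lt_of_hi_lt_lo (FI.mem_mul hC (mem_thin ec.W.hi)) (FI.mem_sqr hA) hregm
    exact lt_of_le_of_lt (mul_le_mul_of_nonneg_left hWI.2 HC) this
  have hq : b₀ * Δ' < 4 * a₀ ^ 2 := by
    have := FI.lt_of_hi_lt_lo (FI.mem_mul hB hD) (FI.mem_mulInt (FI.mem_sqr hA) 4) hregq
    push_cast at this; linarith
  have hedge : scaleNodeN Δ' a₀ b₀ c E / scaleNodeD Δ' a₀ b₀ c E ≤ (V : ℝ) / SC := by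
    have hanti := scaleNode_div_antitone HΔ HC HBC HA.ne' HWlo hWI.1 hm hq
    have hv := scaleNode_div_le_of_valueCheck hval hC (s := 0) (e := (ec.W.lo : ℝ) / SC) hD hA hB (by simpa using h0) (mem_thin ec.W.lo)
    exact hanti.trans hv
  -- (2) the t_pp stage: b = b₀ + sB·(−1)
  set sB := b₀ - b with hsB
  have hsB0 : 0 ≤ sB := by rw [hsB]; linarith
  have eB : b₀ + -sB = b := by rw [hsB]; ring
  have stB := stage_upper hstage h0 h0 hm1 hC hC hν0 hν1 hD hA hB hsB0 hb2 hW (by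
    simp only [mul_zero, add_zero, mul_neg, mul_one, eB]; exact hcrude)
  simp only [mul_zero, add_zero, mul_neg, mul_one, eB] at stB
  obtain ⟨hTB, cb, hcb, hscb, hWB⟩ := stB
  obtain ⟨nb, hnb, rfl⟩ := List.mem_map.1 hcb
  have hray := List.all_eq_true.1 hrays nb hnb
  -- (3) the ray stage on the member family
  have mb : FI.mem b (famOf IB nb.cell.iS (thin (-(SC : ℤ)))) := by
    have := mem_famOf hB hscb hm1; simp only [mul_neg, mul_one, eB] at this; exact this
  have hR := ray_stage_upper hray hC hν0 hν1 hD hA mb hs0 hsR hWB hcrude2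
  have h1s : 0 ≤ 1 + s := by linarith
  calc _ ≤ (1 + s) * (scaleNodeN Δ' a₀ b c (fermiEnergyOf Δ' a₀ b c ν) / scaleNodeD Δ' a₀ b c (fermiEnergyOf Δ' a₀ b c ν)) := hR
    _ ≤ (1 + s) * (scaleNodeN Δ' a₀ b₀ c E / scaleNodeD Δ' a₀ b₀ c E) := mul_le_mul_of_nonneg_left hTB h1s
    _ ≤ (1 + s) * ((V : ℝ) / SC) := mul_le_mul_of_nonneg_left hedge h1s

/-- **EDGE CELL SOUNDNESS, LOWER.** Edge `(Δ′, a₀, b₀)` = `(Δ′, a₁, b₁)`: for every `Δ′` of the cell with `ε_F(Δ′, a₀, b₀, c) ∈ W`, every `b` with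
`b₀ ≤ b`, `(b − b₀)·SC ≤ wB`, every `s ∈ [0, sR/SC]` with `s ≤ 1`: **`(1 − s)·V/SC ≤ T(Δ′, a₀, b − s·b, c − s·c)`**. [folklore] -/
theorem edge_cell_lower (h : edgeCellOK false IC IA IB wB sR V whlo whlo2 ec = true) (hC : FI.mem c IC) (hA : FI.mem a₀ IA) (hB : FI.mem b₀ IB)
    (hν0 : 0 < ν) (hν1 : ν < 1) {Δ' b s : ℝ} (hD : FI.mem Δ' ec.iD) (hW : FI.mem (fermiEnergyOf Δ' a₀ b₀ c ν) ec.W) (hb1 : b₀ ≤ b)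
    (hb2 : (b - b₀) * SC ≤ (wB : ℝ)) (hs0 : 0 ≤ s) (hsR : s * SC ≤ (sR : ℝ)) (hs1 : s ≤ 1) :
    (1 - s) * ((V : ℝ) / SC) ≤ scaleNodeN Δ' a₀ (b - s * b) (c - s * c) (fermiEnergyOf Δ' a₀ (b - s * b) (c - s * c) ν) /
        scaleNodeD Δ' a₀ (b - s * b) (c - s * c) (fermiEnergyOf Δ' a₀ (b - s * b) (c - s * c) ν) := by
  obtain ⟨h1, hm1, h0⟩ := mem_dirs
  unfold edgeCellOK at h
  simp only [Bool.false_eq_true, ↓reduceIte, Bool.and_eq_true, decide_eq_true_eq] at h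
  obtain ⟨⟨⟨⟨⟨⟨⟨⟨⟨hval, hWlo⟩, hD0⟩, hA0⟩, hC0⟩, hBC⟩, hregm⟩, hregq⟩, hstage⟩, hrays⟩ := h
  have HΔ : 0 < Δ' := FI.pos_of_lo_pos hD hD0
  have HA : 0 < a₀ := FI.pos_of_lo_pos hA hA0
  have HC : 0 ≤ c := nonneg_of_lo_nonneg hC hC0
  have HBC : c ≤ b₀ := by have := nonneg_of_lo_nonneg (FI.mem_sub hB hC) hBC; linarith
  have HB : 0 ≤ b₀ := HC.trans HBC
  set E := fermiEnergyOf Δ' a₀ b₀ c ν with hE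
  have hWI := mem_Icc_of_fimem hW
  have HE0 : 0 < E := fermiEnergyOf_pos HΔ HA.ne' HC HB hν0 hν1
  -- (1) the edge value: V/SC ≤ t(·; W.hi) ≤ T̃(Δ′, a₀, b₀)
  have hm : c * ((ec.W.hi : ℝ) / SC) < a₀ ^ 2 := FI.lt_of_hi_lt_lo (FI.mem_mul hC (mem_thin ec.W.hi)) (FI.mem_sqr hA) hregm
  have hq : b₀ * Δ' < 4 * a₀ ^ 2 := by
    have := FI.lt_of_hi_lt_lo (FI.mem_mul hB hD) (FI.mem_mulInt (FI.mem_sqr hA) 4) hregq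
    push_cast at this; linarith
  have hedge : (V : ℝ) / SC ≤ scaleNodeN Δ' a₀ b₀ c E / scaleNodeD Δ' a₀ b₀ c E := by
    have hanti := scaleNode_div_antitone HΔ HC HBC HA.ne' HE0 hWI.2 hm hq
    have hv := le_scaleNode_div_of_valueCheck hval hC (s := 0) (e := (ec.W.hi : ℝ) / SC) hD hA hB (by simpa using h0) (mem_thin ec.W.hi)
    exact hv.trans hanti
  -- (2) the t_pp stage: b = b₀ + sB·(+1)
  set sB := b - b₀ with hsB
  have hsB0 : 0 ≤ sB := by rw [hsB]; linarith
  have eB : b₀ + sB = b := by rw [hsB]; ring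
  have hmono : fermiEnergyOf Δ' a₀ b₀ c ν ≤ fermiEnergyOf (Δ' + sB * 0) (a₀ + sB * 0) (b₀ + sB * 1) c ν := by
    simp only [mul_zero, add_zero, mul_one, eB]
    exact (fermiEnergyOf_mem_Icc_of_mem_box' (Δ := Δ') (a := a₀) (b := b) (c := c) HΔ HA HB HC ⟨le_rfl, le_rfl⟩ ⟨le_rfl, le_rfl⟩ ⟨hb1, le_rfl⟩
      ⟨le_rfl, le_rfl⟩ hν0 hν1).1
  have stB := stage_lower hstage h0 h0 h1 hC hC hν0 hν1 hD hA hB hsB0 hb2 hW hmono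
  simp only [mul_zero, add_zero, mul_one, eB] at stB
  obtain ⟨hTB, cb, hcb, hscb, hWB⟩ := stB
  obtain ⟨nb, hnb, rfl⟩ := List.mem_map.1 hcb
  have hray := List.all_eq_true.1 hrays nb hnb
  -- (3) the ray stage on the member family
  have mb : FI.mem b (famOf IB nb.cell.iS (thin (SC : ℤ))) := by
    have := mem_famOf hB hscb h1; simp only [mul_one, eB] at this; exact this
  have hR := ray_stage_lower hray hC hν0 hν1 hD hA mb hs0 hsR hWB
  have h1s : 0 ≤ 1 - s := by linarith
  calc (1 - s) * ((V : ℝ) / SC) ≤ (1 - s) * (scaleNodeN Δ' a₀ b₀ c E / scaleNodeD Δ' a₀ b₀ c E) := mul_le_mul_of_nonneg_left hedge h1s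
    _ ≤ (1 - s) * (scaleNodeN Δ' a₀ b c (fermiEnergyOf Δ' a₀ b c ν) / scaleNodeD Δ' a₀ b c (fermiEnergyOf Δ' a₀ b c ν)) :=
        mul_le_mul_of_nonneg_left hTB h1s
    _ ≤ _ := hR

end EdgeCell

end Summit.Ventures.CertifiedManyBodySolver.Downfold.Emery
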